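import Literature.MathematicalPhysics.QuantumManyBody.PeriodicConfigFourier
import HarnessLib

/-!
# The autocorrelation kernel on the torus `(ℝ/ℤ)ᵈ` and its Fourier pairing

Topic `Literature/MathematicalPhysics/QuantumManyBody`, namespace `BoseGas` (toolkit for the
infrared bookkeeping of Bose–Einstein condensation proofs on the torus: the "kernel + Parseval"
step that converts bounds on the non-zero Fourier modes of a function `F` and a pointwise lower
bound near the origin into a lower bound on its zero mode).

For a continuous real `θ` on Mathlib's `UnitAddTorus d = d → ℝ/ℤ` (Haar probability measure, the
local `volume` convention of `Mathlib.Analysis.Fourier.AddCircleMulti` and of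
`PeriodicBoseGasFourier.lean`, so that `UnitAddTorus.mFourierCoeff` and the Hilbert basis
`mFourierBasis` apply verbatim) we study the **autocorrelation kernel**
`Φ(t) = ∫ θ(t + s) θ(s) ds`:

* `continuous_autocorr`, `autocorr_nonneg`, `exists_of_autocorr_ne_zero` (support),
  `integral_autocorr` (`∫Φ = (∫θ)²`);
* `mFourierCoeff_autocorr` — the **Wiener–Khinchin identity on the torus** `Φ̂ₙ = |θ̂ₙ|²`
  (Fubini and translation invariance of Haar measure; the convolution theorem for the reflected
  kernel);
* `hasSum_conj_mFourierCoeff_mul` — polarised Parseval `∑ₙ conj(Φ̂ₙ) F̂ₙ = ∫ conj(Φ) F` for plain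
  `L²` functions (Mathlib's `UnitAddTorus.hasSum_prod_mFourierCoeff` for `Lp` classes, unwrapped),
  and `hasSum_autocorr_pairing` — `∑ₙ |θ̂ₙ|² Re F̂ₙ = ∫ Φ · Re F`;
* `autocorr_zero_mode_bound` — the resulting **zero-mode inequality**: if `Re F ≥ γ` on the
  support of `Φ` and the partial sums of `|θ̂ₙ|² Re F̂ₙ` over finite sets of NON-ZERO modes are
  `≤ E`, then `γ(∫θ)² - E ≤ (∫θ)² Re F̂₀`.

Mathlib has the monomials, coefficients, Hilbert basis and Parseval for `Lp` classes
(`Mathlib.Analysis.Fourier.AddCircleMulti`), but no autocorrelation / Wiener–Khinchin statement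
(searched `autocorr`, `mFourierCoeff_conv`); the sibling library
`Literature/Analysis/FunctionSpaces/TorusFourierConvolution.lean` proves the convolution theorem
for Mathlib's group convolution in the GLOBAL `volume` convention, which is not the convention of
the cell transport of `PeriodicBoseGasFourier.lean` used downstream, whence this self-contained
file in the local Haar convention.

## References

* L. Grafakos, *Classical Fourier Analysis*, 3rd ed., GTM 249, Springer 2014, Prop. 3.1.2 (9)
  (Fourier coefficients of a convolution on `Tⁿ`), Prop. 3.2.7 (Parseval/Plancherel on `Tⁿ`).
* N. Wiener, *Generalized harmonic analysis*, Acta Math. 55 (1930) 117–258, §3 (autocorrelation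
  and spectrum).
-/

noncomputable section

open MeasureTheory Set Filter UnitAddTorus
open scoped ENNReal ComplexConjugate

namespace Literature.MathematicalPhysics.QuantumManyBody.BoseGas

-- The measure on `ℝ/ℤ` is the Haar probability measure: the LOCAL instances of
-- `PeriodicConfigFourier.lean` (definitionally those of `Mathlib.Analysis.Fourier.AddCircleMulti`,
-- under which `UnitAddTorus.mFourierCoeff` is defined), re-activated locally; nothing is declared.
attribute [local instance] configFourier_measureSpace configFourier_isProbabilityMeasure
  configFourier_isProbabilityMeasure_pi configFourier_isAddLeftInvariant
  configFourier_isAddLeftInvariant_pi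

variable {d : Type*} [Fintype d]

/-! ### Monomials -/

/-- `e_n(x - y) = e_n(x) conj(e_n(y))`. [folklore] -/
theorem mFourier_apply_sub (n : d → ℤ) (x y : UnitAddTorus d) :
    mFourier n (x - y) = mFourier n x * conj (mFourier n y) := by
  rw [sub_eq_add_neg, mFourier_apply_add, ← mFourier_neg, ← mFourier_neg_apply_neg (-n) y, neg_neg]

/-- `|e_n(x)| = 1`. [folklore] -/
theorem norm_mFourier_eq_one (n : d → ℤ) (x : UnitAddTorus d) : ‖mFourier n x‖ = 1 := by
  simp only [mFourier, ContinuousMap.coe_mk, norm_prod, fourier_apply, Circle.norm_coe,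
    Finset.prod_const_one]

omit [Fintype d] in
/-- A continuous function on the (compact) torus is bounded. [folklore] -/
theorem exists_bound_of_continuous_torus {θ : UnitAddTorus d → ℝ} (hθ : Continuous θ) :
    ∃ C, 0 ≤ C ∧ ∀ t, |θ t| ≤ C := by
  obtain ⟨C, hC⟩ := isCompact_univ.exists_bound_of_continuousOn hθ.continuousOn
  exact ⟨max C 0, le_max_right _ _, fun t => (hC t (mem_univ t)).trans (le_max_left _ _)⟩

/-! ### The autocorrelation kernel `Φ(t) = ∫ θ(t+s)θ(s) ds` -/

/-- **Continuity of the autocorrelation** of a continuous kernel (dominated convergence).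
[folklore] -/
theorem continuous_autocorr {θ : UnitAddTorus d → ℝ} (hθ : Continuous θ) :
    Continuous fun t : UnitAddTorus d => ∫ s, θ (t + s) * θ s := by
  obtain ⟨C, hC0, hC⟩ := exists_bound_of_continuous_torus hθ
  refine continuous_of_dominated (bound := fun _ => C * C) ?_ ?_ (integrable_const _) ?_
  · intro t
    exact ((hθ.comp (continuous_const.add continuous_id)).mul hθ).aestronglyMeasurable
  · intro t
    refine Eventually.of_forall fun s => ?_
    rw [Real.norm_eq_abs, abs_mul]
    exact mul_le_mul (hC _) (hC _) (abs_nonneg _) hC0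
  · exact Eventually.of_forall fun _ =>
      ((hθ.comp (continuous_id.add continuous_const)).mul continuous_const)

/-- The autocorrelation of a non-negative kernel is non-negative. [folklore] -/
theorem autocorr_nonneg {θ : UnitAddTorus d → ℝ} (hθ : ∀ t, 0 ≤ θ t) (t : UnitAddTorus d) :
    0 ≤ ∫ s, θ (t + s) * θ s :=
  integral_nonneg fun _ => mul_nonneg (hθ _) (hθ _)

/-- **Support of the autocorrelation**: `Φ(t) ≠ 0` forces `θ(t + s) ≠ 0 ≠ θ(s)` for some `s`
(so `supp Φ ⊆ supp θ - supp θ`). [folklore] -/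
theorem exists_of_autocorr_ne_zero {θ : UnitAddTorus d → ℝ} {t : UnitAddTorus d}
    (h : (∫ s, θ (t + s) * θ s) ≠ 0) : ∃ s, θ (t + s) ≠ 0 ∧ θ s ≠ 0 := by
  by_contra hcon
  push Not at hcon
  apply h
  refine integral_eq_zero_of_ae (Eventually.of_forall fun s => ?_)
  by_cases hs : θ (t + s) = 0
  · simp [hs]
  · simp [hcon s hs]

/-- **Mass of the autocorrelation**: `∫ Φ = (∫ θ)²` (Fubini, translation invariance). [folklore] -/
theorem integral_autocorr {θ : UnitAddTorus d → ℝ} (hθ : Continuous θ) :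
    ∫ t, (∫ s, θ (t + s) * θ s) = (∫ t, θ t) ^ 2 := by
  have hcont : Continuous fun p : UnitAddTorus d × UnitAddTorus d => θ (p.1 + p.2) * θ p.2 := by
    fun_prop
  have hint : Integrable (fun p : UnitAddTorus d × UnitAddTorus d => θ (p.1 + p.2) * θ p.2)
      (volume.prod volume) := hcont.integrable_of_hasCompactSupport (HasCompactSupport.of_compactSpace _)
  rw [integral_integral_swap hint]
  have h1 : ∀ s, ∫ t, θ (t + s) * θ s = (∫ t, θ t) * θ s := fun s => by
    simp_rw [add_comm _ s]
    rw [integral_mul_const, integral_add_left_eq_self θ s]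
  simp_rw [h1]
  rw [integral_const_mul, sq]

/-! ### Fourier coefficients of real functions and of the autocorrelation -/

/-- `θ̂ₙ = ∫ e_{-n} θ` for a real `θ` (the scalar action unfolded). [folklore] -/
theorem mFourierCoeff_ofReal_eq (θ : UnitAddTorus d → ℝ) (n : d → ℤ) :
    mFourierCoeff (fun t => ((θ t : ℝ) : ℂ)) n = ∫ t, mFourier (-n) t * (θ t : ℂ) := by
  simp only [mFourierCoeff, smul_eq_mul]

/-- `conj(θ̂ₙ) = ∫ e_n θ` for a real `θ`. [folklore] -/
theorem conj_mFourierCoeff_ofReal (θ : UnitAddTorus d → ℝ) (n : d → ℤ) :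
    conj (mFourierCoeff (fun t => ((θ t : ℝ) : ℂ)) n) = ∫ t, mFourier n t * (θ t : ℂ) := by
  rw [mFourierCoeff_ofReal_eq, ← integral_conj]
  refine integral_congr_ae (Eventually.of_forall fun t => ?_)
  simp only [map_mul, Complex.conj_ofReal, mFourier_neg, RingHomCompTriple.comp_apply,
    RingHom.id_apply]

/-- `|θ̂ₙ| ≤ ∫|θ|`. [folklore] -/
theorem norm_mFourierCoeff_ofReal_le (θ : UnitAddTorus d → ℝ) (n : d → ℤ) :
    ‖mFourierCoeff (fun t => ((θ t : ℝ) : ℂ)) n‖ ≤ ∫ t, |θ t| := by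
  rw [mFourierCoeff_ofReal_eq]
  refine (norm_integral_le_integral_norm _).trans (le_of_eq ?_)
  refine integral_congr_ae (Eventually.of_forall fun t => ?_)
  simp only [norm_mul, norm_mFourier_eq_one, one_mul, Complex.norm_real, Real.norm_eq_abs]

/-- `θ̂₀ = ∫ θ`. [folklore] -/
theorem mFourierCoeff_ofReal_zero (θ : UnitAddTorus d → ℝ) :
    mFourierCoeff (fun t => ((θ t : ℝ) : ℂ)) 0 = ((∫ t, θ t : ℝ) : ℂ) := by
  rw [mFourierCoeff_ofReal_eq]
  simp only [neg_zero, mFourier_zero, ContinuousMap.one_apply, one_mul, integral_complex_ofReal]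

/-- **Wiener–Khinchin on the torus**: the Fourier coefficients of the autocorrelation of a
continuous real kernel are the squared moduli of those of the kernel, `Φ̂ₙ = |θ̂ₙ|²` (Fubini, then
the substitution `t ↦ t - s` by translation invariance of Haar measure and
`e_{-n}(u - s) = e_{-n}(u) e_n(s)`). [cite: Grafakos2014, Prop. 3.1.2 (9)] -/
theorem mFourierCoeff_autocorr {θ : UnitAddTorus d → ℝ} (hθ : Continuous θ) (n : d → ℤ) :
    mFourierCoeff (fun t => (((∫ s, θ (t + s) * θ s : ℝ)) : ℂ)) n =
      ((‖mFourierCoeff (fun t => ((θ t : ℝ) : ℂ)) n‖ ^ 2 : ℝ) : ℂ) := by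
  rw [mFourierCoeff_ofReal_eq]
  have h1 : ∀ t : UnitAddTorus d, mFourier (-n) t * (((∫ s, θ (t + s) * θ s : ℝ)) : ℂ) =
      ∫ s, mFourier (-n) t * ((θ (t + s) : ℂ) * (θ s : ℂ)) := by
    intro t
    rw [← integral_complex_ofReal, ← integral_const_mul]
    refine integral_congr_ae (Eventually.of_forall fun s => ?_)
    push_cast; ring
  simp_rw [h1]
  have hcont : Continuous fun p : UnitAddTorus d × UnitAddTorus d =>
      mFourier (-n) p.1 * ((θ (p.1 + p.2) : ℂ) * (θ p.2 : ℂ)) := by fun_prop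
  have hint : Integrable (fun p : UnitAddTorus d × UnitAddTorus d =>
      mFourier (-n) p.1 * ((θ (p.1 + p.2) : ℂ) * (θ p.2 : ℂ))) (volume.prod volume) :=
    hcont.integrable_of_hasCompactSupport (HasCompactSupport.of_compactSpace _)
  rw [integral_integral_swap hint]
  have h2 : ∀ s : UnitAddTorus d, ∫ t, mFourier (-n) t * ((θ (t + s) : ℂ) * (θ s : ℂ)) =
      (mFourier n s * (θ s : ℂ)) * mFourierCoeff (fun t => ((θ t : ℝ) : ℂ)) n := by
    intro s
    have := integral_add_left_eq_self (μ := (volume : Measure (UnitAddTorus d)))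
      (fun u => mFourier (-n) (u - s) * ((θ u : ℂ) * (θ s : ℂ))) s
    simp only [add_comm s, add_sub_cancel_right] at this
    rw [this, mFourierCoeff_ofReal_eq, ← integral_const_mul]
    refine integral_congr_ae (Eventually.of_forall fun u => ?_)
    simp only [mFourier_apply_sub, ← mFourier_neg, neg_neg]
    ring
  simp_rw [h2]
  rw [integral_mul_const, ← conj_mFourierCoeff_ofReal, mul_comm, Complex.mul_conj,
    Complex.normSq_eq_norm_sq]

/-! ### Parseval, polarised, for plain functions -/

/-- The `Lp` class of an `L²` function has the same Fourier coefficients. [folklore] -/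
theorem mFourierCoeff_memLp_toLp {F : UnitAddTorus d → ℂ} (hF : MemLp F 2 volume) (n : d → ℤ) :
    mFourierCoeff ((hF.toLp F : Lp ℂ 2 (volume : Measure (UnitAddTorus d))) : UnitAddTorus d → ℂ) n =
      mFourierCoeff F n :=
  integral_congr_ae (hF.coeFn_toLp.mono fun t ht => by simp only [ht])

/-- A continuous function on the torus is in `L²`. [folklore] -/
theorem memLp_of_continuous_torus {Φ : UnitAddTorus d → ℂ} (hΦ : Continuous Φ) :
    MemLp Φ 2 (volume : Measure (UnitAddTorus d)) := by
  obtain ⟨C, hC⟩ := isCompact_univ.exists_bound_of_continuousOn hΦ.continuousOn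
  exact MemLp.of_bound hΦ.aestronglyMeasurable C (Eventually.of_forall fun t => hC t (mem_univ t))

/-- **Polarised Parseval for functions**: `∑ₙ conj(Φ̂ₙ) F̂ₙ = ∫ conj(Φ) F` for `Φ, F ∈ L²` of the
torus (Mathlib's identity for `Lp` classes, unwrapped). [cite: Grafakos2014, Prop. 3.2.7 (3)] -/
theorem hasSum_conj_mFourierCoeff_mul {Φ F : UnitAddTorus d → ℂ} (hΦ : MemLp Φ 2 volume)
    (hF : MemLp F 2 volume) :
    HasSum (fun n => conj (mFourierCoeff Φ n) * mFourierCoeff F n) (∫ t, conj (Φ t) * F t) := by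
  have h := hasSum_prod_mFourierCoeff (hΦ.toLp Φ) (hF.toLp F)
  simp only [mFourierCoeff_memLp_toLp] at h
  have hint : ∫ t, conj ((hΦ.toLp Φ : UnitAddTorus d → ℂ) t) * (hF.toLp F : UnitAddTorus d → ℂ) t =
      ∫ t, conj (Φ t) * F t :=
    integral_congr_ae (by
      filter_upwards [hΦ.coeFn_toLp, hF.coeFn_toLp] with t h1 h2
      rw [h1, h2])
  rwa [hint] at h

/-- **Parseval for a real continuous function**: `∑ₙ |θ̂ₙ|² = ∫ θ²`. [cite: Grafakos2014, Prop. 3.2.7 (1)] -/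
theorem hasSum_sq_norm_mFourierCoeff_ofReal {θ : UnitAddTorus d → ℝ} (hθ : Continuous θ) :
    HasSum (fun n => ‖mFourierCoeff (fun t => ((θ t : ℝ) : ℂ)) n‖ ^ 2) (∫ t, θ t ^ 2) := by
  have hm : MemLp (fun t => ((θ t : ℝ) : ℂ)) 2 (volume : Measure (UnitAddTorus d)) :=
    memLp_of_continuous_torus (Complex.continuous_ofReal.comp hθ)
  have h := hasSum_sq_mFourierCoeff (hm.toLp _)
  simp only [mFourierCoeff_memLp_toLp] at h
  have hint : ∫ t, ‖(hm.toLp _ : UnitAddTorus d → ℂ) t‖ ^ 2 = ∫ t, θ t ^ 2 :=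
    integral_congr_ae (by
      filter_upwards [hm.coeFn_toLp] with t h1
      rw [h1, Complex.norm_real, Real.norm_eq_abs, sq_abs])
  rwa [hint] at h

/-- Partial sums of Parseval: `∑_{n ∈ s} |θ̂ₙ|² ≤ ∫ θ²`. [folklore] -/
theorem sum_sq_norm_mFourierCoeff_le {θ : UnitAddTorus d → ℝ} (hθ : Continuous θ)
    (s : Finset (d → ℤ)) :
    ∑ n ∈ s, ‖mFourierCoeff (fun t => ((θ t : ℝ) : ℂ)) n‖ ^ 2 ≤ ∫ t, θ t ^ 2 :=
  sum_le_hasSum s (fun n _ => by positivity) (hasSum_sq_norm_mFourierCoeff_ofReal hθ)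

/-- `|θ̂ₙ|² ≤ (∫θ)²` for a non-negative kernel. [folklore] -/
theorem sq_norm_mFourierCoeff_le {θ : UnitAddTorus d → ℝ} (hθ : ∀ t, 0 ≤ θ t) (n : d → ℤ) :
    ‖mFourierCoeff (fun t => ((θ t : ℝ) : ℂ)) n‖ ^ 2 ≤ (∫ t, θ t) ^ 2 := by
  have h := norm_mFourierCoeff_ofReal_le θ n
  have habs : ∫ t, |θ t| = ∫ t, θ t :=
    integral_congr_ae (Eventually.of_forall fun t => abs_of_nonneg (hθ t))
  rw [habs] at h
  exact pow_le_pow_left₀ (norm_nonneg _) h 2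

/-- **The pairing identity with the autocorrelation kernel**: for continuous real `θ` and
`F ∈ L²`, `∑ₙ |θ̂ₙ|² Re F̂ₙ = ∫ Φ · Re F` with `Φ` the autocorrelation of `θ`. [folklore] -/
theorem hasSum_autocorr_pairing {θ : UnitAddTorus d → ℝ} (hθ : Continuous θ)
    {F : UnitAddTorus d → ℂ} (hF : MemLp F 2 volume) :
    HasSum (fun n => ‖mFourierCoeff (fun t => ((θ t : ℝ) : ℂ)) n‖ ^ 2 * (mFourierCoeff F n).re)
      (∫ t, (∫ s, θ (t + s) * θ s) * (F t).re) := by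
  set Φ : UnitAddTorus d → ℂ := fun t => (((∫ s, θ (t + s) * θ s : ℝ)) : ℂ) with hΦdef
  have hΦc : Continuous Φ := Complex.continuous_ofReal.comp (continuous_autocorr hθ)
  have h := hasSum_conj_mFourierCoeff_mul (memLp_of_continuous_torus hΦc) hF
  have hcoef : ∀ n, conj (mFourierCoeff Φ n) * mFourierCoeff F n =
      (((‖mFourierCoeff (fun t => ((θ t : ℝ) : ℂ)) n‖ ^ 2 : ℝ)) : ℂ) * mFourierCoeff F n := by
    intro n
    rw [hΦdef, mFourierCoeff_autocorr hθ, Complex.conj_ofReal]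
  simp only [hcoef] at h
  have hre := Complex.hasSum_re h
  simp only [Complex.re_ofReal_mul] at hre
  convert hre using 1
  have hint : Integrable (fun t => conj (Φ t) * F t) (volume : Measure (UnitAddTorus d)) := by
    obtain ⟨C, hC⟩ := isCompact_univ.exists_bound_of_continuousOn hΦc.continuousOn
    refine (hF.integrable one_le_two).bdd_mul (c := C) ?_ ?_
    · exact (Complex.continuous_conj.comp hΦc).aestronglyMeasurable
    · exact Eventually.of_forall fun t => by
        rw [Complex.norm_conj]; exact hC t (mem_univ t)
  have hre2 := integral_re hint
  simp only [RCLike.re_to_complex] at hre2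
  rw [← hre2]
  refine integral_congr_ae (Eventually.of_forall fun t => ?_)
  simp only [hΦdef, Complex.conj_ofReal, Complex.re_ofReal_mul]

/-! ### The zero-mode inequality -/

/-- **The kernel inequality for the zero mode.** Let `θ ≥ 0` be continuous with autocorrelation
`Φ`, and `F ∈ L²`. If `Re F ≥ γ` wherever `Φ ≠ 0`, and the partial sums of `|θ̂ₙ|² Re F̂ₙ` over
finite sets of non-zero modes are bounded by `E`, then `γ(∫θ)² - E ≤ (∫θ)² Re F̂₀` (from the
pairing identity: `(∫θ)² Re F̂₀ = ∫Φ Re F - ∑_{n≠0}|θ̂ₙ|² Re F̂ₙ`, `∫ Φ Re F ≥ γ∫Φ = γ(∫θ)²`).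
[folklore] -/
theorem autocorr_zero_mode_bound {θ : UnitAddTorus d → ℝ} (hθ : Continuous θ) (hθ0 : ∀ t, 0 ≤ θ t)
    {F : UnitAddTorus d → ℂ} (hF : MemLp F 2 volume) {γ E : ℝ}
    (hγ : ∀ t, (∫ s, θ (t + s) * θ s) ≠ 0 → γ ≤ (F t).re)
    (hE : ∀ s : Finset (d → ℤ), 0 ∉ s →
      ∑ n ∈ s, ‖mFourierCoeff (fun t => ((θ t : ℝ) : ℂ)) n‖ ^ 2 * (mFourierCoeff F n).re ≤ E) :
    γ * (∫ t, θ t) ^ 2 - E ≤ (∫ t, θ t) ^ 2 * (mFourierCoeff F 0).re := by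
  classical
  have hsum := hasSum_autocorr_pairing hθ hF
  set a : (d → ℤ) → ℝ := fun n => ‖mFourierCoeff (fun t => ((θ t : ℝ) : ℂ)) n‖ ^ 2 *
    (mFourierCoeff F n).re with ha
  set S : ℝ := ∫ t, (∫ s, θ (t + s) * θ s) * (F t).re with hS
  have ha0 : a 0 = (∫ t, θ t) ^ 2 * (mFourierCoeff F 0).re := by
    rw [ha]
    simp only [mFourierCoeff_ofReal_zero, Complex.norm_real, Real.norm_eq_abs, sq_abs]
  -- remove the zero mode
  have hupd := hsum.update 0 0
  have hle : 0 - a 0 + S ≤ E := by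
    refine hasSum_le_of_sum_le hupd fun s => ?_
    have hs : ∑ i ∈ s, Function.update a 0 0 i = ∑ i ∈ s.filter (fun i => i ≠ 0), a i := by
      rw [Finset.sum_filter]
      refine Finset.sum_congr rfl fun i _ => ?_
      by_cases hi : i = 0
      · subst hi; simp
      · simp [hi]
    rw [hs]
    exact hE _ (by simp)
  -- lower bound on the pairing integral
  have hSge : γ * (∫ t, θ t) ^ 2 ≤ S := by
    rw [← integral_autocorr hθ, ← integral_const_mul, hS]
    refine integral_mono ?_ ?_ fun t => ?_
    · exact (continuous_const.mul (continuous_autocorr hθ)).integrable_of_hasCompactSupport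
        (HasCompactSupport.of_compactSpace _)
    · obtain ⟨C, hC⟩ := isCompact_univ.exists_bound_of_continuousOn (continuous_autocorr hθ).continuousOn
      refine ((hF.integrable one_le_two).re.bdd_mul (c := C) (continuous_autocorr hθ).aestronglyMeasurable
        (Eventually.of_forall fun t => hC t (mem_univ t))).congr ?_
      exact Eventually.of_forall fun t => by simp [mul_comm]
    · by_cases h0 : (∫ s, θ (t + s) * θ s) = 0
      · simp [h0]
      · have := hγ t h0
        have hnn := autocorr_nonneg hθ0 t
        simp only
        nlinarith
  linarith

end Literature.MathematicalPhysics.QuantumManyBody.BoseGas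

end
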